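import Mathlib
import Literature.Topology.FourManifolds.OneHandleUniqueness

/-!
# Stub `stub_handlebodyChart` of line `mk_friends` for crux `DcrGap`: the two named facts
(item stmt-SmoothPoincare4-16128, route route-SmoothPoincare4-DottedCircleRasmussen)

The conditional reduction of stub D (`helper_handlebodyChart_of_facts2`,
`…DcrGapStubHandlebodyChartReduction.lean`: in a closed simply connected smooth `4`-manifold every
germ chart of the model dotted handlebody `D_k` extends, up to per-handle sphere twists, to a global
chart) rests on two published theorems of differential topology which the tree does not yet prove.
This file STATES them, in the tree's vocabulary and in exactly the form the reduction consumes, as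
cited named facts written inline for relocation by the gate to
`Literature/Topology/FourManifolds/OneHandleUniqueness.lean`:

* `oneHandle_ambientIsotopic_upToTwist` — uniqueness of `1`-handles (tubes along a common core
  arc) rel feet and rel a closed set, up to the fibre twist in `π₁(SO(3)) = ℤ/2` (Hirsch 1976,
  Ch. 4 §5 Thm. 5.3 with Ch. 8 §1 Thm. 1.3);
* `arcs_ambientIsotopic_rel_of_homotopicRel` — finitely many disjoint arcs homotopic rel ends, off
  a closed set, are ambient isotopic rel ends and rel that set (Whitney 1936 §II Thm. 6; Milnor
  1965 Thm. 8.4 and Remark; Hirsch 1976 Ch. 8 §1 Thm. 1.3).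

Both are stated WITHOUT scoped notation (`modelWithCornersSelf ℝ (EuclideanSpace ℝ (Fin 4))` for
`𝓡 4`, `Diffeomorph … ⊤` for `≃ₘ`), so that the relocated Literature file needs no `open` line.
The file also proves the registered helper `helper_handlebodyChart_isCompactCylinder` (the model
solid cylinder `T = {|p₀| ≤ 1, p₁² + p₂² + p₃² ≤ 1}` on which the `1`-handles are read is compact).

References: H. Whitney, *Differentiable manifolds*, Ann. of Math. 37 (1936) §II Thm. 6
[Whitney1936]; J. Milnor, *Lectures on the h-cobordism theorem* (1965), Thm. 8.4 and Remark,
Thm. 5.8 [MilnorHCobordism1965]; M. W. Hirsch, *Differential Topology* (1976), Ch. 4 §5 Thm. 5.3,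
Ch. 8 §1 Thm. 1.3 [HirschDT1976]; A. Kosinski, *Differential Manifolds* (1993), III §3, VI §§5–6
[Kosinski1993].
-/

-- the prescribed namespace `Summit.<P>.<Sub>.…` duplicates `SmoothPoincare4` (P = Sub)
set_option linter.dupNamespace false

noncomputable section

namespace Summit.SmoothPoincare4.SmoothPoincare4.Theorems.DcrGap.MkFriends

/-! ## The two named facts -/

/-- **Registered helper `helper_handlebodyChart_isCompactCylinder`: the model solid cylinder
`T = {p ∈ ℝ⁴ : |p₀| ≤ 1, p₁² + p₂² + p₃² ≤ 1}` — the domain on which the `1`-handles of the facts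
above and of the reduction are read — is compact** (closed, and bounded by `2`). [folklore] -/
theorem helper_handlebodyChart_isCompactCylinder : IsCompact {p : EuclideanSpace ℝ (Fin 4) | |p 0| ≤ 1 ∧ (p 1) ^ 2 + (p 2) ^ 2 + (p 3) ^ 2 ≤ 1} := by
  refine Metric.isCompact_of_isClosed_isBounded ?_ ?_
  · have h0 : Continuous fun p : EuclideanSpace ℝ (Fin 4) => |p 0| := by fun_prop
    have h1 : Continuous fun p : EuclideanSpace ℝ (Fin 4) => (p 1) ^ 2 + (p 2) ^ 2 + (p 3) ^ 2 := by
      fun_prop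
    exact (isClosed_le h0 continuous_const).inter (isClosed_le h1 continuous_const)
  · refine (isBounded_iff_forall_norm_le).2 ⟨2, fun p hp => ?_⟩
    have h : ‖p‖ ^ 2 ≤ 2 ^ 2 := by
      rw [EuclideanSpace.real_norm_sq_eq, Fin.sum_univ_four]
      have h0 : (p 0) ^ 2 ≤ 1 := by
        have := hp.1
        rw [abs_le] at this
        nlinarith [this.1, this.2]
      nlinarith [hp.2, h0]
    nlinarith [norm_nonneg p, h]

end Summit.SmoothPoincare4.SmoothPoincare4.Theorems.DcrGap.MkFriends

end
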